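/-
COR-CM (cells pub-hodgecm / pub-hodgecm2, stage 2 of the Hodge ladder) — TRANSPOSITION SURGE, item (vi) sub-binder S2 / (vi-2)
`supply`, PINNING RECORD, part 1 of 3: the REACH HALF `hReach` of own-htheta's pinned as-printed junction
`Transposition/Item6SupplyPinned.lean` (frozen md5 d5b63e6a671a, binder `hReach` = its l. 191–196), i.e. the tagged S2-CRUX (M-Sh)
of hodge-director/ITEM6-SPLIT.md §(c⁹) / S2-CLARITY.md Table C row C7.  Seat prover-pub-hodgecm2-pin-1-0 (pin-1; coordinator
ruling FINISH-TODAY SWARM 2026-08-21T16:13:55Z (2); path fixed by the pub-hodgecm2 lead NAMING RULING 16:14:26Z (2)).  THEOREMS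
ONLY: no definition, no instance, no named fact, no `variable`, nothing asserted, no proof holes; the universe records `h₁`
(`BallQuotientUniformised`) / `h₃` (`CMAbelianVarietyRealised`) are EXPLICIT binders of each declaration, needed only to STATE the
tree surface `Var.scheme (ballQuotientUniformisedDatum_of h₁) h₃ (.pms …)` of the conclusion (nothing about them is proved or
discharged); every `∀ F`-binder is face-guarded `IsGalois ℚ F → 6 ≤ [F:ℚ] → ι₁ ∈ Φ` (lead RULING «AS-PRINTED JUNCTION T1»).
Nothing under `CorCM/B01/Transposition/` is edited or restated; own-htheta's file is not imported (it is consumed by pin-3's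
`Item6SupplyPinnedAssembly.lean`, which imports both).
FRAMING: HC_CM is NOT proved.
-/
import Literature.NumberTheory.Automorphic.Liu2021.Thm418AsPrinted
import Literature.AlgebraicGeometry.ShimuraVarieties.UnitaryBallModelUnique
import Literature.AlgebraicGeometry.Motives.JacobianOfIso
import Literature.AlgebraicGeometry.Motives.AbelianVarietyBaseChangeFaithful
import Literature.AlgebraicGeometry.HodgeTheory.ComplexConjugationHolds
import Summits.HodgeConjecture.CorCM.CMSideReachOfInverseType
import Summits.HodgeConjecture.CorCM.B01.LevelCovering
import HarnessLib

/-!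
# Item (vi) S2, the pinned junction: `hReach` DERIVED at a component pin of [Liu 2021] §4.2 / App. C

Own-htheta's pinned junction `Model.faceSupply_of_thm418AsPrinted_pinned` (`Transposition/Item6SupplyPinned.lean`) derives B01-S
`U.FaceSupply` from [Liu2021] Thm. 4.18 AS PRINTED (`hLiu : Thm418AsPrinted (D …)`, `Literature.NumberTheory.Automorphic.Liu2021`),
its printed carriers (`hObj`, `hChi`, `hirr`, `hsm`), the choice `hμ`, the CM-side binder `hCM` (pin-2) and ONE Shimura–Albanese binder

  `hReach` — «below some open compact `Ksm`, a non-zero `φ ∈ Hom_E(A_K, A_μ)_ℚ` at an open compact `K ≤ Ksm` yields a non-zero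
  `Alb(P_Γ(V)) ⟶ Aμ … D_μ` on SOME level `Γ` of the tree's `V`-tower, for SOME Albanese datum»

(there l. 191–196; its `Aμ F ι₁ V Φ D_μ : AbelianVariety ℂ` is the pin, intended `A_μ ⊗_{E,ι₁} ℂ`).  `hReach` is not a printed
sentence: it is a consequence-reading of [Liu2021] §4.2 + App. C Prop. C.5 together with non-Liu inputs (h2)–(h5) (S2-CLARITY Table C
row C7).  THIS FILE PROVES `hReach` — verbatim, with its guards — from a SECOND PIN on the Shimura side whose fields are, one by one,
either a printed sentence about Liu's carriers or nothing (a tree theorem discharges it):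

* **(U1) the Hom carrier** [Liu2021, Thm. 4.18 (1), `FJcycle.tex` l. 2239: «we have a canonical isomorphism `Ω(μ)^K ≃ Hom_E(A_K, A_μ)_ℚ`»;
  §4.2 l. 2066 «We denote by `A_K` the Albanese variety `Alb_{X_K}` of `X_K`»; Def. 4.5 (2) l. 1944 «`A_μ` is an abelian variety over
  `E`»]: the carrier `HomK K D_μ` of `Thm418Data` IS (a subgroup of) the `E`-rational group `ℚ ⊗ Hom_E(A_K, A_μ)` of two abelian
  varieties OVER `E = F` — §2 takes `AK K`, `Aμ₀ D_μ : AbelianVariety F` and an injective `homE : HomK K D_μ →+ ℚ ⊗ (AK K ⟶ Aμ₀ D_μ)`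
  (at x1's E-rational datum `Thm418PinE.toData`, where `HomK K D_μ := ℚ ⊗ (AK K ⟶ Aμ₀ D_μ)` by definition, `homE := id`).  From it
  the complex statement «`φ ≠ 0` gives a non-zero `A_K ⊗_{E,ι₁} ℂ ⟶ A_μ ⊗_{E,ι₁} ℂ`» is a THEOREM (binder-1 p288061
  `AbelianVariety.Hom.baseChange_ne_zero`, Görtz–Wedhorn 14.72 (1); `exists_ne_zero_of_tmul_ne_zero`).  §1 keeps the complex
  form `hcar` as a binder so that the theorem composes with ANY complex pin `Aμ` (pin-2's Liu pin `A_{(M_μ, Ψ̃_μ)}` included).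
* **(U3ᶜ) the component presentation** — for `K` open compact below some `Ksm`, «`A_K ⊗_{E,ι₁} ℂ` is the PRODUCT of the Albanese
  varieties of finitely many smooth projective surfaces `X_c`, each uniformised by the ball of `V^{ι₁}` with group `ι₁(Γ_c)`,
  `Γ_c` a (torsion-free, congruence) level of the tree's `V`-tower».  PRINTED as: [Liu2021] §4.2 l. 2060–2066 («Every scheme
  `Sh(𝕍)_K` is smooth, quasi-projective, and of dimension `n − 1` over `E`; it is projective if and only if we are in the Compact
  Case» — here `d = [F⁺:ℚ] ≥ 3`, Compact Case, so `X_K = Sh(𝕍)_K`; «`A_K` the Albanese variety `Alb_{X_K}`»); §2.1 Def. 2.1 (1)–(2)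
  l. 1171–1177 (`∇X` = «the smallest open and closed subscheme of `X × X` containing the diagonal», splitting fields) with the
  Proposition l. 1191 and Def. 2.3 l. 1202–1211 (`Alb_X` corepresents `f : ∇X → A` with `ΔX ⊆ f⁻¹ 0_A`; over a splitting field
  `∇X = ⊔_i X_i × X_i`, so `Alb_{X ⊗ ℂ} = ∏_i Alb_{X_i}`, and `Alb` commutes with base change by the Galois-descent construction of
  the proof l. 1194–1200); App. C Prop. C.5 l. 4627–4637 («for every `τ ∈ Φ_F` and every `τ' ∈ Φ_E` above it, we have an isomorphism
  `{Sh(𝕍)_K ⊗_{E,τ'} τ'(E)}_K ≃ {Sh(G(τ), h_{V(τ),τ'})_K}_K`», `V(τ)` the `τ`-nearby space of Def. C.4 l. 4620–4622, with the FIXED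
  isomorphism `𝔾(𝔸_F^∞) ≃ G(τ)(𝔸^∞)` of l. 4624) and l. 4599 («a projective system of schemes `{Sh(G, h^♭_{V,Φ})_K}_K`, quasi-projective
  and smooth … indexed by NEAT open compact subgroups `K` of `G(𝔸^∞) = U(V)(𝔸_F^∞)`»).  NOT PRINTED in [Liu2021] and used by the
  reading: (h2) the complex points `Sh(G(τ), h_{V(τ),τ'})_K(ℂ) = U(V)(F⁺)\[𝔹² × U(V)(𝔸_{F⁺,f})/K] = ⊔_g Γ_g\𝔹²`, `Γ_g = U(V)(F⁺) ∩ gKg⁻¹`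
  — Deligne 1979 §2.1.2, a TREE THEOREM on the cell's own carriers (`Deligne1979.complexPoints_eq_finite_disjoint_sum`, p290470,
  over `UnitaryGroup.ShimuraSet` / `shimuraSetHomeomorph`) —, holomorphically (Baily–Borel; the cell's record `BallQuotientUniformised`);
  torsion-freeness of the CONJUGATE levels `Γ_g` for neat `K` (Getz–Hahn GTM 300 Lemma 15.2.3) — a TREE THEOREM for
  `K ≤ K_f(n)`, `3 ≤ n`: `UnitaryGroup.torsionFree_arithmeticLevel_map_conj` (htheta-x1, `UnitaryGroupConjugateLevelTorsionFree.lean`),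
  with `Level V` constructors in `CorCM/Geometry/LevelConjugate.lean` (p291831) / `CorCM/LevelConjugate.lean` (binder-2, p292494), so a
  consumer CAN name the level `Γ c : Level V` of every component.  DISCHARGED IN THE KERNEL (no longer in any hypothesis): (h3) a smooth
  projective surface ball-uniformised by `(V^{ι₁}, ι₁(Γ_c))` IS the tree's `Var.scheme … (.pms (pmsCode F ι₁ V Γ_c))` — item6-p2 p289970
  `UnitaryBallModelUnique.exists_iso_of_eq` (Mumford AG I (4.15) over GAGA `arapura2012_cor_15_4_6_holds`) —; (h4) Albanese data
  transport along that isomorphism — item6-p2 p290302 `Jacobian.exists_hom_ne_zero_of_iso` —; «non-zero out of a finite product is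
  non-zero on a factor» — binder-1 `CMReach.exists_inj_comp_ne_zero`.  In particular the tree's CHOSEN surfaces (`Classical.choose`
  inside `pmsRealisation`) occur in NO hypothesis of this file: the consumer presents Liu's components with THEIR uniformisation.

* §1 `Model.pinReach_of_componentPin` — GENERIC complex pin: `(D) (Aμ) (AKc) (hcar) (hComp) ⟹ hReach(Aμ)` verbatim.
* §2 `Model.pinReach_of_componentPinE` — E-RATIONAL pin: `(D) (AK) (Aμ₀) (homE) (hE) (hComp) ⟹ hReach(A_μ ⊗_{E,ι₁} ℂ)`, the target
  being `letI := ι₁.toAlgebra; (Aμ₀ F ι₁ V Φ D_μ).baseChange ℂ` (pin-3's default `Aμ`; x1 `Thm418PinE`).  (U1) is a theorem here.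
* §3 `Model.pinReach_transport` / `Model.pinReach_transport_isIsogeny` — moving `hReach` along a family of non-zero-preserving maps /
  isogenies `Aμ D_μ ⟶ Aμ' D_μ` (e.g. to binder-1's Liu pin `A_{(M_μ, Ψ̃_μ)}`), by `CMReach.comp_ne_zero_of_isIsogeny`.

STRENGTH / T5 (coordinator ruling 2026-08-21T15:33:56Z (3)): the binder family of §1 is {hcar, hComp} (+ data), of §2 {hE, hComp}
(+ data).  Both families are INHABITED by degenerate data ALONE (empty component set `C := PEmpty` with `AKc K` / `AK K` a trivial
abelian variety — `AbelianVariety.trivial` —, resp. `HomK := ℚ ⊗ Hom`, `homE := id`), so no contradiction is derivable from the pin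
binders by themselves; the content enters with `hLiu ∧ hirr ∧ hsm` (a non-zero `φ` at small `K`).  §1 (complex tokens `AKc`, `Aμ`):
a family closing the END DISPLAY stays ⟺ B01-S in kernel content (own-htheta's certificate `Item6SupplyPinnedCertificate.lean`,
htheta-x2 T1 v7).  §2 (E-rational `AK`, `Aμ₀` over `F`, `hE` injective): the closing family FORCES, at every guarded context, a NON-ZERO
`F`-homomorphism `AK K ⟶ Aμ₀ D_μ` of abelian varieties OVER `F` with `AK K ⊗ ℂ ≅ ∏ Alb` and `Aμ₀ D_μ ⊗ ℂ` CM up to isogeny — an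
`F`-MODEL statement that B01-S does not give back in the kernel (htheta-x2 g4 `X2EPIN.fmodels_of_pinE_family`, `X2P3.eSocket_of_family`):
class O (object pin), NO «↔ B01-S» certificate, relative consistency NOT kernel-certifiable — it rests on [Liu2021] Def. 4.5 (2) /
Prop. 4.6 (1) / §4.2 / App. C positing `A_μ`, `A_K` over `E` (x1 PIN-TYPED §3d: the first pin at which the cite carries kernel
strength beyond B01-S).  What the pin changes on the Shimura side is the CLASSIFICATION of the residual: `hReach` (one
consequence-reading) ↦ (U3ᶜ) alone, whose clauses are printed ([Liu2021] Prop. C.5, Def. 2.3, l. 4599) or tree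
theorems on tree carriers (p290470, `BallQuotientUniformised`, `torsionFree_arithmeticLevel_map_conj`), the link from Liu's token
`X_K` to a `ℂ`-scheme being carrier instantiation (checked by an auditor, not by the kernel — Shimura varieties over `E` do not exist in
the tree).  No printed HYPOTHESIS of [Liu2021] Thm. 4.18 / App. C fails at a general Galois CM field of degree `≥ 6` or a general
face; what is posited is Liu's OBJECTS (`X_K`, `A_K`, `A_μ` over `E`).  HC_CM is NOT proved.

References: Y. Liu, *Fourier–Jacobi cycles and arithmetic relative trace formula*, Camb. J. Math. 9 (2021) = arXiv:2102.11518
(`FJcycle.tex` md5 6db49a74122d): §2.1 Def. 2.1 l. 1171–1185, Prop. l. 1190–1200, Def. 2.3 l. 1202–1211; §4.2 l. 2053–2076; Def. 4.5 (2)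
l. 1944; Thm. 4.18 (1) l. 2239; App. C l. 4575–4599, Def. C.3 l. 4614–4616, Def. C.4 l. 4620–4624, Prop. C.5 l. 4627–4637, Def. C.6
l. 4640–4642, l. 4656 («projective if `d > 1`»).  P. Deligne, *Variétés de Shimura* (Corvallis 1979) §2.1.2.  D. Mumford, *Algebraic
Geometry I* (1981) §4B (4.15); *Abelian Varieties* (1970) §19.  U. Görtz, T. Wedhorn, *Algebraic Geometry I* (2020) Thm. 14.72 (1).
J. Getz, H. Hahn, *An Introduction to Automorphic Representations* (GTM 300, 2024) §15.2, Lemma 15.2.3.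
-/

noncomputable section

open scoped TensorProduct

namespace Summit.HodgeConjecture.CorCM.Model

open CategoryTheory CategoryTheory.Limits AlgebraicGeometry NumberField
open Literature.AlgebraicGeometry.Motives
open Literature.AlgebraicGeometry.HodgeTheory
open Literature.AlgebraicGeometry.ShimuraVarieties
open Literature.NumberTheory.Automorphic
open Literature.NumberTheory.Automorphic.PicardCM
open Literature.NumberTheory.Automorphic.Liu2021

/-! ## §1  GENERIC complex pin: (U1) a Hom carrier + (U3ᶜ) a component presentation ⟹ `hReach` -/

section Generic

/-- **`hReach` at a COMPONENT PIN, generic complex target** (`U = picardCMUniverse hHD hI h₁ h₃`; conclusion = own-htheta's binder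
`hReach` of `Model.faceSupply_of_thm418AsPrinted_pinned` VERBATIM, for the consumer's datum family `D` and complex pin `Aμ`).
Second pin `AKc F ι₁ V Φ K : AbelianVariety ℂ` (intended `A_K ⊗_{E,ι₁} ℂ`, `A_K := Alb_{X_K}`, [Liu2021] §4.2 l. 2066) and two binders,
each demanded only for Galois CM `F` with `6 ≤ [F:ℚ]`, `Φ ∋ ι₁`, every `V`:
* `hcar`  — (U1): at an open compact `K`, a non-zero `φ ∈ Hom_E(A_K, A_μ)_ℚ` (the carrier `HomK K D_μ` of [Liu2021] Thm. 4.18 (1),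
  l. 2239) gives a non-zero complex homomorphism `A_K ⊗_{E,ι₁} ℂ ⟶ Aμ … D_μ` (base change of homomorphisms is faithful; a THEOREM at
  the E-rational pin, §2);
* `hComp` — (U3ᶜ), a READING BINDER, NOT a printed sentence (red-team (A) AUDIT-CITESCOPE D4.3; the citation tag of this declaration
  does NOT cover it): below some open compact `Ksm`, `A_K ⊗_{E,ι₁} ℂ` is a PRODUCT (limit fan `π`) of the Albanese varieties (`𝒥 c`, the tree's
  `Jacobian` = Albanese datum) of finitely many `ℂ`-surfaces `X c`, each carrying a ball uniformisation
  `B c : UnitaryBallUniformisationDatum 2 (X c)` with complex Gram matrix `V.Hm^{ι₁}` and group `ι₁(Γ_c)` for a level `Γ c : Level V`.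
  It READS the printed passages [Liu2021] §4.2 l. 2060–2066 («sufficiently small», `X_K`, `A_K := Alb_{X_K}`), Def. 2.1/2.3
  l. 1171–1211 (`Alb` via `∇X`: Albanese of `⊔_c X_c` is `∏_c Alb X_c`, compatible with base change), App. C Prop. C.5 l. 4627–4637
  with Def. C.4 l. 4620–4624 and «neat» l. 4599, TOGETHER WITH the non-Liu inputs: (h2) complex points `⊔_g Γ_g\𝔹²` = Deligne 1979
  §2.1.2 (tree `Deligne1979.complexPoints_eq_finite_disjoint_sum`); neat ⇒ torsion-free conjugate levels = Getz–Hahn Lemma 15.2.3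
  (tree `UnitaryGroup.torsionFree_arithmeticLevel_map_conj`); (h3)/(h4) model identification and Albanese transport (tree theorems,
  used INSIDE the proof, not assumed).  What it posits beyond those is (R1): that the presented `X c` ARE Liu's components.
KERNEL: `hcar`; a non-zero map out of a product is non-zero on a factor (`CMReach.exists_inj_comp_ne_zero`); the factor's surface IS
the tree's `P_{Γ_c}(V)` (`UnitaryBallModelUnique.exists_iso_of_eq`, Hodge models from `exists_isReal_hodgeModel_holds`, anisotropy
from `6 ≤ [F:ℚ]` by `isAnisotropic_pmsCode_of_two_lt`, ball data matched by clauses `datum_H`/`datum_Γ` of `pmsRealisation` and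
`PicardCode.ofHermitian_H_map`/`_Γ_map`); Albanese transport `Jacobian.exists_hom_ne_zero_of_iso`.  No degree- or face-specific
input beyond the guard.  HC_CM is NOT proved; `hcar`, `hComp` are not inhabited here.  CITATION SCOPE of the tag: only the
carrier sentences that `hcar`/`AKc` quote (Thm. 4.18 (1) l. 2239: the group `Hom_E(A_K, A_μ)_ℚ`; §4.2 l. 2066: `A_K := Alb_{X_K}`);
`hComp` is a reading binder (above) and the derivation itself is ours.
[cite: Liu2021, Thm. 4.18 (1) (FJcycle.tex l. 2239) and §4.2 l. 2066 (carriers `Hom_E(A_K, A_μ)_ℚ`, `A_K`)] -/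
theorem pinReach_of_componentPin
    (h₁ : BallQuotientUniformised) (h₃ : CMAbelianVarietyRealised)
    (D : ∀ (F : CMField) (ι₁ : F →+* ℂ) (_ : HermSpace3 F ι₁) (_ : CMType F), Thm418Data (maximalRealSubfield F) F)
    (Aμ : ∀ (F : CMField) (ι₁ : F →+* ℂ) (V : HermSpace3 F ι₁) (Φ : CMType F), (D F ι₁ V Φ).Obj → AbelianVariety ℂ)
    (AKc : ∀ (F : CMField) (ι₁ : F →+* ℂ) (V : HermSpace3 F ι₁) (Φ : CMType F), Subgroup (D F ι₁ V Φ).G → AbelianVariety ℂ)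
    (hcar : ∀ (F : CMField), IsGalois ℚ F → 6 ≤ Module.finrank ℚ F → ∀ (Φ : CMType F) (ι₁ : F →+* ℂ), ι₁ ∈ Φ.1 →
      ∀ (V : HermSpace3 F ι₁) (K : Subgroup (D F ι₁ V Φ).G) (Dμ : (D F ι₁ V Φ).Obj) (φ : (D F ι₁ V Φ).HomK K Dμ),
        IsOpenCompact K → φ ≠ 0 → ∃ f : AKc F ι₁ V Φ K ⟶ Aμ F ι₁ V Φ Dμ, f ≠ 0)
    (hComp : ∀ (F : CMField), IsGalois ℚ F → 6 ≤ Module.finrank ℚ F → ∀ (Φ : CMType F) (ι₁ : F →+* ℂ), ι₁ ∈ Φ.1 →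
      ∀ V : HermSpace3 F ι₁, ∃ Ksm : Subgroup (D F ι₁ V Φ).G, IsOpenCompact Ksm ∧
        ∀ K : Subgroup (D F ι₁ V Φ).G, IsOpenCompact K → K ≤ Ksm →
          ∃ (C : Type) (_ : Fintype C) (X : C → SchemeOver ℂ) (B : ∀ c, UnitaryBallUniformisationDatum 2 (X c))
            (Γ : C → Level V) (𝒥 : ∀ c, Jacobian (X c)) (π : ∀ c, AKc F ι₁ V Φ K ⟶ (𝒥 c).J),
            (∀ c, (B c).Hℂ = V.Hm.map ι₁) ∧
            (∀ c, (B c).Γ.map (Matrix.GeneralLinearGroup.map (B c).τ₁) =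
              (Γ c).Γ.map (Matrix.GeneralLinearGroup.map ι₁)) ∧
            Nonempty (IsLimit (Fan.mk (AKc F ι₁ V Φ K) π))) :
    ∀ (F : CMField), IsGalois ℚ F → 6 ≤ Module.finrank ℚ F → ∀ (Φ : CMType F) (ι₁ : F →+* ℂ), ι₁ ∈ Φ.1 →
      ∀ V : HermSpace3 F ι₁, ∃ Ksm : Subgroup (D F ι₁ V Φ).G, IsOpenCompact Ksm ∧
        ∀ (K : Subgroup (D F ι₁ V Φ).G) (Dμ : (D F ι₁ V Φ).Obj) (φ : (D F ι₁ V Φ).HomK K Dμ),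
          IsOpenCompact K → K ≤ Ksm → φ ≠ 0 →
            ∃ (Γ : Level V) (𝒥 : Jacobian (Var.scheme (ballQuotientUniformisedDatum_of h₁) h₃ (.pms (pmsCode F ι₁ V Γ))))
              (w : 𝒥.J ⟶ Aμ F ι₁ V Φ Dμ), w ≠ 0 := by
  classical
  intro F hG h6 Φ ι₁ hι V
  obtain ⟨Ksm, hKsm, hcomp⟩ := hComp F hG h6 Φ ι₁ hι V
  refine ⟨Ksm, hKsm, fun K Dμ φ hK hle hφ => ?_⟩
  -- (U1): a non-zero complex homomorphism `A_K ⊗ ℂ ⟶ Aμ Dμ`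
  obtain ⟨f, hf⟩ := hcar F hG h6 Φ ι₁ hι V K Dμ φ hK hφ
  -- (U3ᶜ): the component presentation at `K`
  obtain ⟨C, _, X, B, Γ, 𝒥, π, hH, hΓ, ⟨hlim⟩⟩ := hcomp K hK hle
  -- non-zero on some factor `Alb(X_c)`
  obtain ⟨c, s, -, hs⟩ := CMReach.exists_inj_comp_ne_zero hlim hf
  -- the factor's surface is the tree's `P_{Γ_c}(V)`: model uniqueness for equal ball data
  have hF : 2 < Module.finrank ℚ F := by omega
  have han : (pmsCode F ι₁ V (Γ c)).IsAnisotropic := isAnisotropic_pmsCode_of_two_lt hF (Γ c)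
  set hU := ballQuotientUniformisedDatum_of h₁ with hU_def
  have hHc : (B c).Hℂ = (Var.ballDatum hU h₃ (pmsCode F ι₁ V (Γ c)) han).Hℂ := by
    rw [hH c]
    change V.Hm.map ι₁ = ((pmsRealisation hU _).datum han).H.map ((pmsRealisation hU _).datum han).E.subtype
    rw [(pmsRealisation hU (pmsCode F ι₁ V (Γ c))).datum_H han]
    exact (PicardCode.ofHermitian_H_map ι₁ V.Hm (Γ c).Γ V.isHermitian V.signature_ι₁ V.posDef_of_ne
      (Γ c).isCongruence (Γ c).torsionFree).symm
  have hΓc : (B c).Γ.map (Matrix.GeneralLinearGroup.map (B c).τ₁) =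
      (Var.ballDatum hU h₃ (pmsCode F ι₁ V (Γ c)) han).Γ.map
        (Matrix.GeneralLinearGroup.map (Var.ballDatum hU h₃ (pmsCode F ι₁ V (Γ c)) han).τ₁) := by
    rw [hΓ c]
    change _ = ((pmsRealisation hU _).datum han).Γ.map
      (Matrix.GeneralLinearGroup.map ((pmsRealisation hU _).datum han).E.subtype)
    rw [(pmsRealisation hU (pmsCode F ι₁ V (Γ c))).datum_Γ han]
    exact (PicardCode.ofHermitian_Γ_map ι₁ V.Hm (Γ c).Γ V.isHermitian V.signature_ι₁ V.posDef_of_ne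
      (Γ c).isCongruence (Γ c).torsionFree).symm
  obtain ⟨A₁, -⟩ := exists_isReal_hodgeModel_holds 2 (X c) (B c).isSmoothProjective
  obtain ⟨A₂, -⟩ := exists_isReal_hodgeModel_holds 2 _ (Var.ballDatum hU h₃ (pmsCode F ι₁ V (Γ c)) han).isSmoothProjective
  obtain ⟨e, -, -⟩ := UnitaryBallModelUnique.exists_iso_of_eq A₁ A₂ hHc hΓc
  -- transport the Albanese datum along `e`
  obtain ⟨𝒥', w, hw⟩ := (𝒥 c).exists_hom_ne_zero_of_iso e hs
  exact ⟨Γ c, 𝒥', w, hw⟩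

end Generic

/-! ## §2  The E-RATIONAL pin: (U1) is a theorem; target `A_μ ⊗_{E,ι₁} ℂ := (Aμ₀ D_μ).baseChange ℂ` along `ι₁` -/

section ERational

/-- **`hReach` at the E-RATIONAL COMPONENT PIN** (`U = picardCMUniverse hHD hI h₁ h₃`): carriers OVER `E = F` — `AK F ι₁ V Φ K :
AbelianVariety F` («`A_K` the Albanese variety `Alb_{X_K}` of `X_K`», [Liu2021] §4.2 l. 2066, `X_K` a smooth projective scheme over `E`,
l. 2062–2064) and `Aμ₀ F ι₁ V Φ D_μ : AbelianVariety F` («`A_μ` is an abelian variety over `E`», Def. 4.5 (2) l. 1944) — and the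
identification (U1) of the Hom carrier of [Liu2021] Thm. 4.18 (1) (l. 2239, «`Hom_E(A_K, A_μ)_ℚ`») with the `E`-rational group:
an INJECTIVE `homE : HomK K D_μ →+ ℚ ⊗_ℤ Hom_F(AK K, Aμ₀ D_μ)` (identity at x1's `Thm418PinE.toData`).  The pin of own-htheta's junction is
then `Aμ … D_μ := A_μ ⊗_{E,ι₁} ℂ = (letI := ι₁.toAlgebra; (Aμ₀ … D_μ).baseChange ℂ)`, and the binder `hcar` of §1 is DISCHARGED: a
non-zero element of `ℚ ⊗ Hom_F` has a non-zero `f : A_K ⟶ A_μ` behind it (`exists_ne_zero_of_tmul_ne_zero`), and `f ⊗_{E,ι₁} ℂ ≠ 0`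
(binder-1 p288061 `AbelianVariety.Hom.baseChange_ne_zero`, Görtz–Wedhorn Thm. 14.72 (1)).  Remaining binder: `hComp` = (U3ᶜ) of §1 read
at `A_K ⊗_{E,ι₁} ℂ := (AK … K).baseChange ℂ` — a READING binder exactly as in §1 (not covered by the tag).  HC_CM is NOT proved;
`hComp` is not inhabited here.  CITATION SCOPE of the tag: the carrier sentences (Thm. 4.18 (1) l. 2239 `Hom_E(A_K, A_μ)_ℚ`; §4.2
l. 2066 `A_K`; Def. 4.5 (2) l. 1944 `A_μ` over `E`) and Görtz–Wedhorn for (U1); the derivation is ours.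
[cite: Liu2021, Thm. 4.18 (1) (FJcycle.tex l. 2239), §4.2 l. 2066 and Def. 4.5 (2) l. 1944 (carriers `Hom_E(A_K, A_μ)_ℚ`, `A_K`, `A_μ`)]
[cite: GortzWedhorn2020, Theorem 14.72 (1)] -/
theorem pinReach_of_componentPinE
    (h₁ : BallQuotientUniformised) (h₃ : CMAbelianVarietyRealised)
    (D : ∀ (F : CMField) (ι₁ : F →+* ℂ) (_ : HermSpace3 F ι₁) (_ : CMType F), Thm418Data (maximalRealSubfield F) F)
    (AK : ∀ (F : CMField) (ι₁ : F →+* ℂ) (V : HermSpace3 F ι₁) (Φ : CMType F), Subgroup (D F ι₁ V Φ).G → AbelianVariety F)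
    (Aμ₀ : ∀ (F : CMField) (ι₁ : F →+* ℂ) (V : HermSpace3 F ι₁) (Φ : CMType F), (D F ι₁ V Φ).Obj → AbelianVariety F)
    (homE : ∀ (F : CMField) (ι₁ : F →+* ℂ) (V : HermSpace3 F ι₁) (Φ : CMType F) (K : Subgroup (D F ι₁ V Φ).G)
      (Dμ : (D F ι₁ V Φ).Obj), (D F ι₁ V Φ).HomK K Dμ →+ ℚ ⊗[ℤ] (AK F ι₁ V Φ K ⟶ Aμ₀ F ι₁ V Φ Dμ))
    (hE : ∀ (F : CMField) (ι₁ : F →+* ℂ) (V : HermSpace3 F ι₁) (Φ : CMType F) (K : Subgroup (D F ι₁ V Φ).G)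
      (Dμ : (D F ι₁ V Φ).Obj), Function.Injective (homE F ι₁ V Φ K Dμ))
    (hComp : ∀ (F : CMField), IsGalois ℚ F → 6 ≤ Module.finrank ℚ F → ∀ (Φ : CMType F) (ι₁ : F →+* ℂ), ι₁ ∈ Φ.1 →
      ∀ V : HermSpace3 F ι₁, ∃ Ksm : Subgroup (D F ι₁ V Φ).G, IsOpenCompact Ksm ∧
        ∀ K : Subgroup (D F ι₁ V Φ).G, IsOpenCompact K → K ≤ Ksm →
          ∃ (C : Type) (_ : Fintype C) (X : C → SchemeOver ℂ) (B : ∀ c, UnitaryBallUniformisationDatum 2 (X c))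
            (Γ : C → Level V) (𝒥 : ∀ c, Jacobian (X c))
            (π : ∀ c, (letI := ι₁.toAlgebra; (AK F ι₁ V Φ K).baseChange ℂ) ⟶ (𝒥 c).J),
            (∀ c, (B c).Hℂ = V.Hm.map ι₁) ∧
            (∀ c, (B c).Γ.map (Matrix.GeneralLinearGroup.map (B c).τ₁) =
              (Γ c).Γ.map (Matrix.GeneralLinearGroup.map ι₁)) ∧
            Nonempty (IsLimit (Fan.mk (letI := ι₁.toAlgebra; (AK F ι₁ V Φ K).baseChange ℂ) π))) :
    ∀ (F : CMField), IsGalois ℚ F → 6 ≤ Module.finrank ℚ F → ∀ (Φ : CMType F) (ι₁ : F →+* ℂ), ι₁ ∈ Φ.1 →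
      ∀ V : HermSpace3 F ι₁, ∃ Ksm : Subgroup (D F ι₁ V Φ).G, IsOpenCompact Ksm ∧
        ∀ (K : Subgroup (D F ι₁ V Φ).G) (Dμ : (D F ι₁ V Φ).Obj) (φ : (D F ι₁ V Φ).HomK K Dμ),
          IsOpenCompact K → K ≤ Ksm → φ ≠ 0 →
            ∃ (Γ : Level V) (𝒥 : Jacobian (Var.scheme (ballQuotientUniformisedDatum_of h₁) h₃ (.pms (pmsCode F ι₁ V Γ))))
              (w : 𝒥.J ⟶ (letI := ι₁.toAlgebra; (Aμ₀ F ι₁ V Φ Dμ).baseChange ℂ)), w ≠ 0 := by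
  refine pinReach_of_componentPin h₁ h₃ D (fun F ι₁ V Φ Dμ => letI := ι₁.toAlgebra; (Aμ₀ F ι₁ V Φ Dμ).baseChange ℂ)
    (fun F ι₁ V Φ K => letI := ι₁.toAlgebra; (AK F ι₁ V Φ K).baseChange ℂ) ?_ hComp
  intro F _ _ Φ ι₁ _ V K Dμ φ _ hφ
  letI := ι₁.toAlgebra
  -- `homE φ ≠ 0` in `ℚ ⊗ Hom_F(A_K, A_μ)`
  have hx : homE F ι₁ V Φ K Dμ φ ≠ 0 := fun h => hφ (hE F ι₁ V Φ K Dμ (by rw [h, map_zero]))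
  -- a non-zero `F`-homomorphism behind it, non-zero after base change to `ℂ`
  obtain ⟨f, hf⟩ := exists_ne_zero_of_tmul_ne_zero hx
  exact ⟨AbelianVariety.Hom.baseChange ℂ f, AbelianVariety.Hom.baseChange_ne_zero ℂ hf⟩

end ERational

/-! ## §3  Transport of `hReach` along a family `Aμ ⟶ Aμ'` (e.g. isogenies to binder-1's Liu pin) -/

section Transport

/-- **Transport of `hReach` along non-zero-preserving maps of pins**: if every non-zero `X ⟶ Aμ … D_μ` yields a non-zero `X ⟶ Aμ' … D_μ`
(on the guarded range) then `hReach` at the pin `Aμ` gives `hReach` at the pin `Aμ'` (same `Ksm`).  For pin-3: composes §1/§2 with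
pin-2's choice of `Aμ` when the two pins differ by an isogeny (`pinReach_transport_isIsogeny`). [folklore] -/
theorem pinReach_transport
    (h₁ : BallQuotientUniformised) (h₃ : CMAbelianVarietyRealised)
    (D : ∀ (F : CMField) (ι₁ : F →+* ℂ) (_ : HermSpace3 F ι₁) (_ : CMType F), Thm418Data (maximalRealSubfield F) F)
    (Aμ Aμ' : ∀ (F : CMField) (ι₁ : F →+* ℂ) (V : HermSpace3 F ι₁) (Φ : CMType F), (D F ι₁ V Φ).Obj → AbelianVariety ℂ)
    (hT : ∀ (F : CMField), IsGalois ℚ F → 6 ≤ Module.finrank ℚ F → ∀ (Φ : CMType F) (ι₁ : F →+* ℂ), ι₁ ∈ Φ.1 →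
      ∀ (V : HermSpace3 F ι₁) (Dμ : (D F ι₁ V Φ).Obj) (X : AbelianVariety ℂ) (w : X ⟶ Aμ F ι₁ V Φ Dμ), w ≠ 0 →
        ∃ w' : X ⟶ Aμ' F ι₁ V Φ Dμ, w' ≠ 0)
    (h : ∀ (F : CMField), IsGalois ℚ F → 6 ≤ Module.finrank ℚ F → ∀ (Φ : CMType F) (ι₁ : F →+* ℂ), ι₁ ∈ Φ.1 →
      ∀ V : HermSpace3 F ι₁, ∃ Ksm : Subgroup (D F ι₁ V Φ).G, IsOpenCompact Ksm ∧
        ∀ (K : Subgroup (D F ι₁ V Φ).G) (Dμ : (D F ι₁ V Φ).Obj) (φ : (D F ι₁ V Φ).HomK K Dμ),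
          IsOpenCompact K → K ≤ Ksm → φ ≠ 0 →
            ∃ (Γ : Level V) (𝒥 : Jacobian (Var.scheme (ballQuotientUniformisedDatum_of h₁) h₃ (.pms (pmsCode F ι₁ V Γ))))
              (w : 𝒥.J ⟶ Aμ F ι₁ V Φ Dμ), w ≠ 0) :
    ∀ (F : CMField), IsGalois ℚ F → 6 ≤ Module.finrank ℚ F → ∀ (Φ : CMType F) (ι₁ : F →+* ℂ), ι₁ ∈ Φ.1 →
      ∀ V : HermSpace3 F ι₁, ∃ Ksm : Subgroup (D F ι₁ V Φ).G, IsOpenCompact Ksm ∧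
        ∀ (K : Subgroup (D F ι₁ V Φ).G) (Dμ : (D F ι₁ V Φ).Obj) (φ : (D F ι₁ V Φ).HomK K Dμ),
          IsOpenCompact K → K ≤ Ksm → φ ≠ 0 →
            ∃ (Γ : Level V) (𝒥 : Jacobian (Var.scheme (ballQuotientUniformisedDatum_of h₁) h₃ (.pms (pmsCode F ι₁ V Γ))))
              (w : 𝒥.J ⟶ Aμ' F ι₁ V Φ Dμ), w ≠ 0 := by
  intro F hG h6 Φ ι₁ hι V
  obtain ⟨Ksm, hKsm, hreach⟩ := h F hG h6 Φ ι₁ hι V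
  refine ⟨Ksm, hKsm, fun K Dμ φ hK hle hφ => ?_⟩
  obtain ⟨Γ, 𝒥, w, hw⟩ := hreach K Dμ φ hK hle hφ
  obtain ⟨w', hw'⟩ := hT F hG h6 Φ ι₁ hι V Dμ 𝒥.J w hw
  exact ⟨Γ, 𝒥, w', hw'⟩

/-- **Transport of `hReach` along ISOGENIES of pins** `t … D_μ : Aμ … D_μ ⟶ Aμ' … D_μ` (a non-zero `w` stays non-zero after an isogeny:
binder-1 `CMReach.comp_ne_zero_of_isIsogeny`, Mumford AV §19 Remark p. 169).  Use: `Aμ` = the E-rational pin `A_μ ⊗_{E,ι₁} ℂ` of §2,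
`Aμ'` = binder-1's Liu pin `A_{(M_μ, Ψ̃_μ)}` (`CorCM/LiuValueFieldPin.lean`), `t` = the isogeny between two realisations of one CM type.
[cite: MumfordAV1970, §19 Remark p. 169] -/
theorem pinReach_transport_isIsogeny
    (h₁ : BallQuotientUniformised) (h₃ : CMAbelianVarietyRealised)
    (D : ∀ (F : CMField) (ι₁ : F →+* ℂ) (_ : HermSpace3 F ι₁) (_ : CMType F), Thm418Data (maximalRealSubfield F) F)
    (Aμ Aμ' : ∀ (F : CMField) (ι₁ : F →+* ℂ) (V : HermSpace3 F ι₁) (Φ : CMType F), (D F ι₁ V Φ).Obj → AbelianVariety ℂ)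
    (t : ∀ (F : CMField) (ι₁ : F →+* ℂ) (V : HermSpace3 F ι₁) (Φ : CMType F) (Dμ : (D F ι₁ V Φ).Obj),
      Aμ F ι₁ V Φ Dμ ⟶ Aμ' F ι₁ V Φ Dμ)
    (ht : ∀ (F : CMField), IsGalois ℚ F → 6 ≤ Module.finrank ℚ F → ∀ (Φ : CMType F) (ι₁ : F →+* ℂ), ι₁ ∈ Φ.1 →
      ∀ (V : HermSpace3 F ι₁) (Dμ : (D F ι₁ V Φ).Obj), AbelianVariety.IsIsogeny (t F ι₁ V Φ Dμ))
    (h : ∀ (F : CMField), IsGalois ℚ F → 6 ≤ Module.finrank ℚ F → ∀ (Φ : CMType F) (ι₁ : F →+* ℂ), ι₁ ∈ Φ.1 →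
      ∀ V : HermSpace3 F ι₁, ∃ Ksm : Subgroup (D F ι₁ V Φ).G, IsOpenCompact Ksm ∧
        ∀ (K : Subgroup (D F ι₁ V Φ).G) (Dμ : (D F ι₁ V Φ).Obj) (φ : (D F ι₁ V Φ).HomK K Dμ),
          IsOpenCompact K → K ≤ Ksm → φ ≠ 0 →
            ∃ (Γ : Level V) (𝒥 : Jacobian (Var.scheme (ballQuotientUniformisedDatum_of h₁) h₃ (.pms (pmsCode F ι₁ V Γ))))
              (w : 𝒥.J ⟶ Aμ F ι₁ V Φ Dμ), w ≠ 0) :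
    ∀ (F : CMField), IsGalois ℚ F → 6 ≤ Module.finrank ℚ F → ∀ (Φ : CMType F) (ι₁ : F →+* ℂ), ι₁ ∈ Φ.1 →
      ∀ V : HermSpace3 F ι₁, ∃ Ksm : Subgroup (D F ι₁ V Φ).G, IsOpenCompact Ksm ∧
        ∀ (K : Subgroup (D F ι₁ V Φ).G) (Dμ : (D F ι₁ V Φ).Obj) (φ : (D F ι₁ V Φ).HomK K Dμ),
          IsOpenCompact K → K ≤ Ksm → φ ≠ 0 →
            ∃ (Γ : Level V) (𝒥 : Jacobian (Var.scheme (ballQuotientUniformisedDatum_of h₁) h₃ (.pms (pmsCode F ι₁ V Γ))))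
              (w : 𝒥.J ⟶ Aμ' F ι₁ V Φ Dμ), w ≠ 0 :=
  pinReach_transport h₁ h₃ D Aμ Aμ' (fun F hG h6 Φ ι₁ hι V Dμ _ w hw =>
    ⟨w ≫ t F ι₁ V Φ Dμ, CMReach.comp_ne_zero_of_isIsogeny (ht F hG h6 Φ ι₁ hι V Dμ) hw⟩) h

end Transport

end Summit.HodgeConjecture.CorCM.Model

end
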